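import Mathlib

/-!
# KPlusLogSqLaw — the reach-3 step lemma of the static corridor calculus (two-speed model rung), as kernel theorems

HONEST FRAMING.  Helper infrastructure for the conjb-2 lineage's realisable model law `HullDComb({±1,±2})` of the crux `TropicalB`
(item `stmt-ValiantsHypothesis-19771`, route `KPlusLogSqLaw`, cell `pub-symmetroid`; seat conjb-2 g21, 2026-08-29, THEORY-NOTE-g21 §3).
In the STATIC form of that law (val-sym-lift-p4's particle calculus THEOREM T transported to two-speed slope walks) one studies, for
lines `S k θ = b k + s k * θ`, the set `T[i,j]` of sweep times `θ` at which the window `[i,j]` is SEPARATED: every even-indexed line of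
the window strictly above every odd-indexed one.  A «plateau step» at a bad row is the configuration `T[0,3] ≠ ∅`, `T[1,4] ≠ ∅`,
`T[0,4] = ∅` for five consecutive lines whose slopes satisfy the two-speed sign pattern of a bad reach-3 row:
`s 1 < s 0 ≤ s 3`, `s 1 < s 2 < s 3`, `s 1 ≤ s 4` (word `λ₀, λ₁ > 0 > λ₂` with `λ₀ ≤ λ₁ + |λ₂|` and `λ₁ + |λ₂| + λ₃ ≥ 0`, automatic
for an alphabet `{±p, ±q}` with `q ≤ 2p`).

* `affine_pair_witness` : the one-dimensional Helly-type engine — a non-increasing affine `f` positive at `x`, a non-decreasing affine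
  `g` positive at `y ≥ x`, and `g > 0` wherever `f = 0` on `[x,y]`, have a common point of positivity in `[x,y]`.
* `reach3_sepFull_of_le` : if some B-time `θB ∈ T[1,4]` is `≤` some A-time `θA ∈ T[0,3]`, then `T[0,4] ≠ ∅` (no step with `T_B` before `T_A`).
* `reach3_sepFull_of_slope` : if `s 4 ≤ s 3` or `s 0 = s 3`, then `T[0,3] ≠ ∅ ∧ T[1,4] ≠ ∅ → T[0,4] ≠ ∅`.
* `reach3_step_forces` (LEMMA S3 of THEORY-NOTE-g21) : a step (`T[0,3]`, `T[1,4]` inhabited, `T[0,4]` empty) forces `s 3 < s 4`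
  (in word terms `λ₃ > 0`: the run after the sign change has length one) and `s 0 < s 3` (strictly `λ₀ < λ₁ + |λ₂|`), and every A-time
  lies strictly before every B-time.

Plain statements about five real lines; nothing here asserts anything about `HullDComb`, `TropicalB`, `WeakLifting`, `KPlusLogSqLaw`,
`MatrixDescartes` or `VP ≠ VNP`.  Located counterpart (conjb-2 g21, `csrc/stepfeas`, `csrc/chainseq`): for the alphabet `{±1,±2}` the
reach-3 step is realisable for exactly the 14 of 32 sign-`++-+` words allowed by this lemma.
-/

set_option linter.dupNamespace false
set_option autoImplicit false

namespace Summit.ValiantsHypothesis.ValiantsHypothesis.Theorems.KPlusLogSqLawReachThreeStep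

/-- One-dimensional Helly-type engine.  `f θ = fa + fb * θ` non-increasing and positive at `x`; `g θ = ga + gb * θ` non-decreasing and
positive at `y`, `x ≤ y`; and on `[x,y]` the root of `f` (if any) is a point where `g > 0`.  Then some `θ ∈ [x,y]` has `f θ > 0` and
`g θ > 0`. -/
theorem affine_pair_witness (x y fa fb ga gb : ℝ) (hxy : x ≤ y) (hfb : fb ≤ 0) (hgb : 0 ≤ gb)
    (hfx : 0 < fa + fb * x) (hgy : 0 < ga + gb * y)
    (hcouple : ∀ θ, x ≤ θ → θ ≤ y → fa + fb * θ = 0 → 0 < ga + gb * θ) :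
    ∃ θ, x ≤ θ ∧ θ ≤ y ∧ 0 < fa + fb * θ ∧ 0 < ga + gb * θ := by
  by_cases hgx0 : 0 < ga + gb * x
  · exact ⟨x, le_rfl, hxy, hfx, hgx0⟩
  by_cases hfy0 : 0 < fa + fb * y
  · exact ⟨y, hxy, le_rfl, hfy0, hgy⟩
  have hgx : ga + gb * x ≤ 0 := not_lt.mp hgx0
  have hfy : fa + fb * y ≤ 0 := not_lt.mp hfy0
  have hfb' : fb < 0 := by
    rcases lt_or_eq_of_le hfb with h | h
    · exact h
    · exfalso
      rw [h] at hfx hfy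
      linarith
  -- the root of `f`
  have hfb0 : fb ≠ 0 := ne_of_lt hfb'
  set r : ℝ := -fa / fb with hr
  have hfbr : fb * r = -fa := by
    rw [hr]
    field_simp
  have hfr : fa + fb * r = 0 := by linarith
  have hxr : x < r := by
    rw [hr, lt_div_iff_of_neg hfb']
    linarith
  have hry : r ≤ y := by
    rw [hr, div_le_iff_of_neg hfb']
    linarith
  have hgr : 0 < ga + gb * r := hcouple r hxr.le hry hfr
  have hgb' : 0 < gb := by
    rcases lt_or_eq_of_le hgb with h | h
    · exact h
    · exfalso
      rw [← h] at hgx hgr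
      linarith
  -- back off the root by a small `δ`
  set δ : ℝ := min ((r - x) / 2) ((ga + gb * r) / (2 * gb)) with hδ
  have hδ1 : δ ≤ (r - x) / 2 := min_le_left _ _
  have hδ2 : δ ≤ (ga + gb * r) / (2 * gb) := min_le_right _ _
  have hδpos : 0 < δ := lt_min (by linarith) (div_pos hgr (by linarith))
  have hδ2' : gb * δ ≤ (ga + gb * r) / 2 := by
    have h1 : gb * δ ≤ gb * ((ga + gb * r) / (2 * gb)) := mul_le_mul_of_nonneg_left hδ2 hgb
    have h2 : gb * ((ga + gb * r) / (2 * gb)) = (ga + gb * r) / 2 := by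
      field_simp
    linarith
  refine ⟨r - δ, by linarith, by linarith, ?_, ?_⟩
  · have h1 : fa + fb * (r - δ) = -(fb * δ) := by rw [mul_sub]; linarith
    rw [h1]
    have h2 : fb * δ < 0 := mul_neg_of_neg_of_pos hfb' hδpos
    linarith
  · have h1 : ga + gb * (r - δ) = (ga + gb * r) - gb * δ := by ring
    rw [h1]
    linarith

/-! «Window `[0,4]` separated at `θ`» is spelled out below as the six strict inequalities: lines `0, 2, 4` strictly above
lines `1, 3`. -/

/-- No step with a B-time before an A-time: if `θB ≤ θA`, `[0,3]` is separated at `θA` and `[1,4]` at `θB`, then `[0,4]` is separated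
somewhere in `[θB, θA]` — for the slope pattern `s 1 < s 0 ≤ s 3`, `s 1 < s 2 < s 3`, `s 1 ≤ s 4` (no hypothesis on `s 4` versus `s 3`;
of the B-inequalities only `S1 < S2`, `S1 < S4`, `S3 < S4` at `θB` are used). -/
theorem reach3_sepFull_of_le (s0 s1 s2 s3 s4 b0 b1 b2 b3 b4 θA θB : ℝ)
    (h10 : s1 < s0) (h12 : s1 < s2) (h23 : s2 < s3) (h03 : s0 ≤ s3) (h14 : s1 ≤ s4)
    (hA01 : b1 + s1 * θA < b0 + s0 * θA) (hA03 : b3 + s3 * θA < b0 + s0 * θA)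
    (hA21 : b1 + s1 * θA < b2 + s2 * θA) (hA23 : b3 + s3 * θA < b2 + s2 * θA)
    (hB21 : b1 + s1 * θB < b2 + s2 * θB)
    (hB41 : b1 + s1 * θB < b4 + s4 * θB) (hB43 : b3 + s3 * θB < b4 + s4 * θB)
    (hBA : θB ≤ θA) :
    ∃ θ, θB ≤ θ ∧ θ ≤ θA ∧
      (b1 + s1 * θ < b0 + s0 * θ ∧ b3 + s3 * θ < b0 + s0 * θ ∧ b1 + s1 * θ < b2 + s2 * θ ∧ b3 + s3 * θ < b2 + s2 * θ ∧
        b1 + s1 * θ < b4 + s4 * θ ∧ b3 + s3 * θ < b4 + s4 * θ) := by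
  by_cases h34 : s3 ≤ s4
  · -- witness θA
    have p1 : 0 ≤ (s4 - s3) * (θA - θB) := mul_nonneg (by linarith) (by linarith)
    have p2 : 0 ≤ (s4 - s1) * (θA - θB) := mul_nonneg (by linarith) (by linarith)
    refine ⟨θA, hBA, le_rfl, hA01, hA03, hA21, hA23, ?_, ?_⟩
    · nlinarith
    · nlinarith
  · have h34 : s4 < s3 := not_le.mp h34
    -- f = S4 - S3 (decreasing), g = S0 - S1 (increasing) on [θB, θA]
    obtain ⟨θ, hθB, hθA, hf, hg⟩ := affine_pair_witness θB θA (b4 - b3) (s4 - s3) (b0 - b1) (s0 - s1) hBA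
      (by linarith) (by linarith) (by linarith) (by linarith) (by
        intro θ h1 h2 h0
        have p1 : 0 ≤ (s3 - s0) * (θA - θ) := mul_nonneg (by linarith) (by linarith)
        have p2 : 0 ≤ (s4 - s1) * (θ - θB) := mul_nonneg (by linarith) (by linarith)
        nlinarith)
    have p1 : 0 ≤ (s3 - s0) * (θA - θ) := mul_nonneg (by linarith) (by linarith)
    have p2 : 0 ≤ (s2 - s1) * (θ - θB) := mul_nonneg (by linarith) (by linarith)
    have p3 : 0 ≤ (s3 - s2) * (θA - θ) := mul_nonneg (by linarith) (by linarith)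
    have p4 : 0 ≤ (s4 - s1) * (θ - θB) := mul_nonneg (by linarith) (by linarith)
    refine ⟨θ, hθB, hθA, ?_, ?_, ?_, ?_, ?_, ?_⟩
    · nlinarith
    · nlinarith
    · nlinarith
    · nlinarith
    · nlinarith
    · nlinarith

/-- If `s 4 ≤ s 3` or `s 0 = s 3` then `T[0,3] ≠ ∅` and `T[1,4] ≠ ∅` give `T[0,4] ≠ ∅` (slope pattern as above). -/
theorem reach3_sepFull_of_slope (s0 s1 s2 s3 s4 b0 b1 b2 b3 b4 θA θB : ℝ)
    (h10 : s1 < s0) (h12 : s1 < s2) (h23 : s2 < s3) (h03 : s0 ≤ s3) (h14 : s1 ≤ s4)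
    (hstep : s4 ≤ s3 ∨ s0 = s3)
    (hA01 : b1 + s1 * θA < b0 + s0 * θA) (hA03 : b3 + s3 * θA < b0 + s0 * θA)
    (hA21 : b1 + s1 * θA < b2 + s2 * θA) (hA23 : b3 + s3 * θA < b2 + s2 * θA)
    (hB21 : b1 + s1 * θB < b2 + s2 * θB) (hB23 : b3 + s3 * θB < b2 + s2 * θB)
    (hB41 : b1 + s1 * θB < b4 + s4 * θB) (hB43 : b3 + s3 * θB < b4 + s4 * θB) :
    ∃ θ, (b1 + s1 * θ < b0 + s0 * θ ∧ b3 + s3 * θ < b0 + s0 * θ ∧ b1 + s1 * θ < b2 + s2 * θ ∧ b3 + s3 * θ < b2 + s2 * θ ∧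
        b1 + s1 * θ < b4 + s4 * θ ∧ b3 + s3 * θ < b4 + s4 * θ) := by
  rcases le_total θB θA with hBA | hAB
  · obtain ⟨θ, -, -, hθ⟩ := reach3_sepFull_of_le s0 s1 s2 s3 s4 b0 b1 b2 b3 b4 θA θB h10 h12 h23 h03 h14
      hA01 hA03 hA21 hA23 hB21 hB41 hB43 hBA
    exact ⟨θ, hθ⟩
  · rcases hstep with h43 | h03eq
    · -- f = S0 - S3 (non-increasing), g = S4 - S1 (non-decreasing) on [θA, θB]
      obtain ⟨θ, hθA, hθB, hf, hg⟩ := affine_pair_witness θA θB (b0 - b3) (s0 - s3) (b4 - b1) (s4 - s1) hAB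
        (by linarith) (by linarith) (by linarith) (by linarith) (by
          intro θ h1 h2 h0
          have p1 : 0 ≤ (s0 - s1) * (θ - θA) := mul_nonneg (by linarith) (by linarith)
          have p2 : 0 ≤ (s3 - s4) * (θB - θ) := mul_nonneg (by linarith) (by linarith)
          nlinarith)
      have p1 : 0 ≤ (s0 - s1) * (θ - θA) := mul_nonneg (by linarith) (by linarith)
      have p2 : 0 ≤ (s2 - s1) * (θ - θA) := mul_nonneg (by linarith) (by linarith)
      have p3 : 0 ≤ (s3 - s2) * (θB - θ) := mul_nonneg (by linarith) (by linarith)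
      have p4 : 0 ≤ (s3 - s4) * (θB - θ) := mul_nonneg (by linarith) (by linarith)
      refine ⟨θ, ?_, ?_, ?_, ?_, ?_, ?_⟩
      · nlinarith
      · nlinarith
      · nlinarith
      · nlinarith
      · nlinarith
      · nlinarith
    · -- s0 = s3 : witness θB
      subst h03eq
      have p1 : 0 ≤ (s0 - s1) * (θB - θA) := mul_nonneg (by linarith) (by linarith)
      refine ⟨θB, ?_, ?_, hB21, hB23, hB41, hB43⟩
      · nlinarith
      · nlinarith

/-- **LEMMA S3 (reach-3 step; THEORY-NOTE-g21 §3.2).**  Five lines `S k θ = b k + s k θ` with the bad-reach-3 two-speed slope pattern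
`s 1 < s 0 ≤ s 3`, `s 1 < s 2 < s 3`, `s 1 ≤ s 4`.  If the windows `[0,3]` and `[1,4]` are each separated at some time but the window
`[0,4]` never is (a plateau step `J(1) = J(0) + 1` at a bad row of reach 3), then `s 3 < s 4` (the letter after the sign change has the
sign of the run: `λ₃ > 0`), `s 0 < s 3` (strict triangle inequality `λ₀ < λ₁ + |λ₂|`), and every A-time precedes every B-time. -/
theorem reach3_step_forces (s0 s1 s2 s3 s4 b0 b1 b2 b3 b4 θA θB : ℝ)
    (h10 : s1 < s0) (h12 : s1 < s2) (h23 : s2 < s3) (h03 : s0 ≤ s3) (h14 : s1 ≤ s4)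
    (hA01 : b1 + s1 * θA < b0 + s0 * θA) (hA03 : b3 + s3 * θA < b0 + s0 * θA)
    (hA21 : b1 + s1 * θA < b2 + s2 * θA) (hA23 : b3 + s3 * θA < b2 + s2 * θA)
    (hB21 : b1 + s1 * θB < b2 + s2 * θB) (hB23 : b3 + s3 * θB < b2 + s2 * θB)
    (hB41 : b1 + s1 * θB < b4 + s4 * θB) (hB43 : b3 + s3 * θB < b4 + s4 * θB)
    (hnot : ∀ θ, ¬ (b1 + s1 * θ < b0 + s0 * θ ∧ b3 + s3 * θ < b0 + s0 * θ ∧ b1 + s1 * θ < b2 + s2 * θ ∧ b3 + s3 * θ < b2 + s2 * θ ∧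
        b1 + s1 * θ < b4 + s4 * θ ∧ b3 + s3 * θ < b4 + s4 * θ)) :
    s3 < s4 ∧ s0 < s3 ∧ θA < θB := by
  refine ⟨?_, ?_, ?_⟩
  · by_cases h : s4 ≤ s3
    · exfalso
      obtain ⟨θ, hθ⟩ := reach3_sepFull_of_slope s0 s1 s2 s3 s4 b0 b1 b2 b3 b4 θA θB h10 h12 h23 h03 h14 (Or.inl h)
        hA01 hA03 hA21 hA23 hB21 hB23 hB41 hB43
      exact hnot θ hθ
    · exact not_le.mp h
  · rcases lt_or_eq_of_le h03 with h | h
    · exact h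
    · exfalso
      obtain ⟨θ, hθ⟩ := reach3_sepFull_of_slope s0 s1 s2 s3 s4 b0 b1 b2 b3 b4 θA θB h10 h12 h23 h03 h14 (Or.inr h)
        hA01 hA03 hA21 hA23 hB21 hB23 hB41 hB43
      exact hnot θ hθ
  · by_cases h : θB ≤ θA
    · exfalso
      obtain ⟨θ, -, -, hθ⟩ := reach3_sepFull_of_le s0 s1 s2 s3 s4 b0 b1 b2 b3 b4 θA θB h10 h12 h23 h03 h14
        hA01 hA03 hA21 hA23 hB21 hB41 hB43 h
      exact hnot θ hθ
    · exact not_le.mp h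

end Summit.ValiantsHypothesis.ValiantsHypothesis.Theorems.KPlusLogSqLawReachThreeStep
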